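import Summits.CriticalPhenomena.CardyFormulaZ2.Theorems.CardyFlipRussoVoronoiHubFromSmirnovCountTail
import Summits.CriticalPhenomena.CardyFormulaZ2.Theorems.CardyFlipRussoVoronoiHubFromSmirnovGridNet
import Summits.CriticalPhenomena.CardyFormulaZ2.Theorems.CardyFlipRussoVoronoiHubFromSmirnovVoidBall

/-!
# Stub `poisson_closePair_le` of line `moebius-exact-delaunay-dilation-ward`
# (crux `VoronoiHubFromSmirnov`, stmt-CriticalPhenomena-6433)

Close pairs of nuclei are rare. In the conformal transport of I. Benjamini, O. Schramm,
*Conformal invariance of Voronoi percolation*, Comm. Math. Phys. 197 (1998) 75–107 (§3 and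
Lemma 4.2), the degenerate (`k = 1`) potential defects reduce to two nuclei abnormally close to
each other. For a Poisson point process `P` on `ℂ` whose intensity `μ` is dominated by
`M₀ · Lebesgue` (`M₀ ≥ 0`) and scales `0 < τ ≤ ρ`, the probability that the configuration has two
distinct nuclei `a ≠ b` with `a ∈ closedBall 0 ρ` and `dist a b < τ` is at most
`(4ρ/τ + 1)² · (M₀ π (2τ)²)² / 2`.

Proof.
* Let `X` be a finite `τ`-net of `closedBall 0 ρ` by open `τ`-balls with `|X| ≤ (4ρ/τ + 1)²`
  (`exists_finset_net_closedBall`).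
* Inclusion `{∃ a ≠ b ∈ c, a ∈ closedBall 0 ρ, dist a b < τ} ⊆ ⋃_{x ∈ X} {N_c(B(x, 2τ)) ≥ 2}`:
  `a ∈ B(x, τ)` for some `x ∈ X`, whence `a, b ∈ B(x, 2τ)` by the triangle inequality, and two
  distinct points of `c` in a set give count `≥ 2` (`Set.encard_pair`).
* Union bound for `Measure.real` (`measureReal_mono`, `measureReal_biUnion_finset_le`; `P` is a
  probability measure) and, termwise, the Poisson count tail `P(N(s) ≥ 2) ≤ μ(s)²/2!`
  (`poisson_count_tail_le`) with `μ(B(x, 2τ)) ≤ M₀ · |B(x, 2τ)| = M₀ π (2τ)²`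
  (`vb_volume_ball_toReal`).
* Finally `∑_{x ∈ X} bound = |X| · bound ≤ (4ρ/τ + 1)² · bound`.

No new definitions; tree facts and Mathlib only.
-/

noncomputable section

namespace Summit.CriticalPhenomena.CardyFormulaZ2.Cruxes.VoronoiHubFromSmirnov.MoebiusExactDelaunayDilationWard

open MeasureTheory Literature.Analysis.FunctionSpaces
open scoped ENNReal NNReal

/-- Two distinct points `a ≠ b` of a configuration `c`, both lying in `s`, force `N_c(s) ≥ 2`
(`{a, b} ⊆ c ∩ s` and `Set.encard_pair`). -/
theorem cp_two_le_count {c : PointConfig ℂ} {s : Set ℂ} {a b : ℂ} (ha : a ∈ c) (hb : b ∈ c)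
    (hab : a ≠ b) (has : a ∈ s) (hbs : b ∈ s) : ((2 : ℕ) : ℕ∞) ≤ c.count s := by
  have hsub : ({a, b} : Set ℂ) ⊆ c.carrier ∩ s :=
    Set.insert_subset ⟨ha, has⟩ (Set.singleton_subset_iff.mpr ⟨hb, hbs⟩)
  rw [PointConfig.count, Nat.cast_ofNat, ← Set.encard_pair hab]
  exact Set.encard_le_encard hsub

/-- Deterministic inclusion: if `closedBall 0 ρ` is covered by the balls `B(x, τ)`, `x ∈ X`, then a
configuration with two distinct points `a`, `b`, `a ∈ closedBall 0 ρ`, `dist a b < τ`, has at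
least two points in one of the doubled balls `B(x, 2τ)`: pick `x ∈ X` with `a ∈ B(x, τ)`; then
`dist b x ≤ dist b a + dist a x < 2τ`. -/
theorem cp_closePairSet_subset (X : Finset ℂ) (ρ τ : ℝ)
    (hX : Metric.closedBall (0 : ℂ) ρ ⊆ ⋃ x ∈ X, Metric.ball x τ) :
    {c : PointConfig ℂ | ∃ a ∈ c, ∃ b ∈ c, a ≠ b ∧ a ∈ Metric.closedBall (0 : ℂ) ρ ∧ dist a b < τ}
      ⊆ ⋃ x ∈ X, {c : PointConfig ℂ | ((2 : ℕ) : ℕ∞) ≤ c.count (Metric.ball x (2 * τ))} := by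
  rintro c ⟨a, ha, b, hb, hab, haρ, habτ⟩
  obtain ⟨x, hxX, hax⟩ := Set.mem_iUnion₂.mp (hX haρ)
  refine Set.mem_iUnion₂.mpr ⟨x, hxX, ?_⟩
  rw [Metric.mem_ball] at hax
  have h0 : 0 ≤ dist a x := dist_nonneg
  have ha2 : a ∈ Metric.ball x (2 * τ) := by
    rw [Metric.mem_ball]
    linarith
  have hb2 : b ∈ Metric.ball x (2 * τ) := by
    rw [Metric.mem_ball]
    have h1 : dist b x ≤ dist b a + dist a x := dist_triangle b a x
    have h2 : dist b a = dist a b := dist_comm b a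
    linarith
  exact cp_two_le_count ha hb hab ha2 hb2

/-- One term of the union bound: for a Poisson process `P` with intensity `μ ≤ M₀ · Lebesgue`
(`M₀ ≥ 0`) and `τ ≥ 0`, `P(N(B(x, 2τ)) ≥ 2) ≤ (M₀ π (2τ)²)² / 2` (`poisson_count_tail_le` with
`k = 2`, `μ(B(x, 2τ)) ≤ M₀ π (2τ)²`). -/
theorem cp_term_le {μ : Measure ℂ} {P : Measure (PointConfig ℂ)} (M₀ : ℝ)
    (hP : IsPoissonPointProcess μ P) (hM₀ : 0 ≤ M₀)
    (hμ : ∀ S : Set ℂ, MeasurableSet S → μ S ≤ ENNReal.ofReal M₀ * volume S)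
    (x : ℂ) {τ : ℝ} (hτ : 0 ≤ τ) :
    P.real {c : PointConfig ℂ | ((2 : ℕ) : ℕ∞) ≤ c.count (Metric.ball x (2 * τ))} ≤
      (M₀ * Real.pi * (2 * τ) ^ 2) ^ 2 / 2 := by
  have hle : μ (Metric.ball x (2 * τ)) ≤ ENNReal.ofReal M₀ * volume (Metric.ball x (2 * τ)) :=
    hμ _ measurableSet_ball
  have hfin' : ENNReal.ofReal M₀ * volume (Metric.ball x (2 * τ)) ≠ ⊤ :=
    ENNReal.mul_ne_top ENNReal.ofReal_ne_top measure_ball_lt_top.ne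
  have hfin : μ (Metric.ball x (2 * τ)) ≠ ⊤ := ne_top_of_le_ne_top hfin' hle
  have hreal : (μ (Metric.ball x (2 * τ))).toReal ≤ M₀ * Real.pi * (2 * τ) ^ 2 := by
    calc (μ (Metric.ball x (2 * τ))).toReal
        ≤ (ENNReal.ofReal M₀ * volume (Metric.ball x (2 * τ))).toReal :=
          ENNReal.toReal_mono hfin' hle
      _ = M₀ * Real.pi * (2 * τ) ^ 2 := by
          rw [ENNReal.toReal_mul, ENNReal.toReal_ofReal hM₀,
            vb_volume_ball_toReal x (by positivity : (0 : ℝ) ≤ 2 * τ)]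
          ring
  have h0 : 0 ≤ (μ (Metric.ball x (2 * τ))).toReal := ENNReal.toReal_nonneg
  calc P.real {c : PointConfig ℂ | ((2 : ℕ) : ℕ∞) ≤ c.count (Metric.ball x (2 * τ))}
      ≤ (μ (Metric.ball x (2 * τ))).toReal ^ 2 / ((2 : ℕ).factorial : ℝ) :=
        poisson_count_tail_le hP measurableSet_ball hfin 2
    _ = (μ (Metric.ball x (2 * τ))).toReal ^ 2 / 2 := by
        rw [Nat.factorial_two, Nat.cast_ofNat]
    _ ≤ (M₀ * Real.pi * (2 * τ) ^ 2) ^ 2 / 2 :=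
        div_le_div_of_nonneg_right (pow_le_pow_left₀ h0 hreal 2) (by norm_num)

/-- **Close pairs of nuclei are rare** (Benjamini–Schramm 1998, the degenerate potential defects
of the conformal transport, §3 and Lemma 4.2): for a Poisson point process `P` on `ℂ` with
intensity `μ ≤ M₀ · Lebesgue` (`M₀ ≥ 0`) and `0 < τ ≤ ρ`, the probability of two distinct nuclei
`a`, `b` with `a ∈ closedBall 0 ρ` and `dist a b < τ` is at most
`(4ρ/τ + 1)² · (M₀ π (2τ)²)² / 2` (a `τ`-net of the disc, the Poisson count tail at `k = 2` on
the doubled balls, and a union bound). -/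
theorem poisson_closePair_le : ∀ {μ : MeasureTheory.Measure ℂ} {P : MeasureTheory.Measure (Literature.Analysis.FunctionSpaces.PointConfig ℂ)} (M₀ : ℝ), Literature.Analysis.FunctionSpaces.IsPoissonPointProcess μ P → 0 ≤ M₀ → (∀ S : Set ℂ, MeasurableSet S → μ S ≤ ENNReal.ofReal M₀ * MeasureTheory.volume S) → ∀ (ρ τ : ℝ), 0 < τ → τ ≤ ρ → P.real {c | ∃ a ∈ c, ∃ b ∈ c, a ≠ b ∧ a ∈ Metric.closedBall (0 : ℂ) ρ ∧ dist a b < τ} ≤ (4 * ρ / τ + 1) ^ 2 * ((M₀ * Real.pi * (2 * τ) ^ 2) ^ 2 / 2) := by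
  intro μ P M₀ hP hM₀ hμ ρ τ hτ hτρ
  haveI := hP.isProbabilityMeasure
  obtain ⟨X, hXcard, hXcov⟩ :=
    exists_finset_net_closedBall (Metric.closedBall (0 : ℂ) ρ) τ ρ hτ hτρ subset_rfl
  have hB : 0 ≤ (M₀ * Real.pi * (2 * τ) ^ 2) ^ 2 / 2 := by positivity
  calc P.real {c | ∃ a ∈ c, ∃ b ∈ c, a ≠ b ∧ a ∈ Metric.closedBall (0 : ℂ) ρ ∧ dist a b < τ}
      ≤ P.real (⋃ x ∈ X,
          {c : PointConfig ℂ | ((2 : ℕ) : ℕ∞) ≤ c.count (Metric.ball x (2 * τ))}) :=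
        measureReal_mono (cp_closePairSet_subset X ρ τ hXcov) (measure_ne_top _ _)
    _ ≤ ∑ x ∈ X, P.real {c : PointConfig ℂ | ((2 : ℕ) : ℕ∞) ≤ c.count (Metric.ball x (2 * τ))} :=
        measureReal_biUnion_finset_le _ _
    _ ≤ ∑ x ∈ X, (M₀ * Real.pi * (2 * τ) ^ 2) ^ 2 / 2 :=
        Finset.sum_le_sum fun x _ => cp_term_le M₀ hP hM₀ hμ x hτ.le
    _ = X.card * ((M₀ * Real.pi * (2 * τ) ^ 2) ^ 2 / 2) := by
        rw [Finset.sum_const, nsmul_eq_mul]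
    _ ≤ (4 * ρ / τ + 1) ^ 2 * ((M₀ * Real.pi * (2 * τ) ^ 2) ^ 2 / 2) :=
        mul_le_mul_of_nonneg_right hXcard hB

end Summit.CriticalPhenomena.CardyFormulaZ2.Cruxes.VoronoiHubFromSmirnov.MoebiusExactDelaunayDilationWard

end
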